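import Literature.NumberTheory.Rogawski1990.TamagawaSingularMembersFinTFLetter        -- (R2) `TamagawaSingularMembersFinTF` — the finite ∕ top-form residual letter
import Literature.NumberTheory.Rogawski1990.ArchSingularMembersPinRatioClasses          -- ★ p844170 (b2)+(b3) (+ ★ (W4g) p844084, ★ (W4f) p844053)
import Literature.NumberTheory.Rogawski1990.ArchSingularStableClassFrames              -- ★ p844172 (b5, F0P3-p03 (g11)): `exists_isSingularArchFrame_of_guard` — frames at every guard point off the centre
import Literature.NumberTheory.Rogawski1990.ArchCanonicalSingularHaar                   -- ★ p844141 (b1): `νGi`, `νqi` are Haar under `hACS` (+ ★ (W4e) `exists_rational_diagonal_frame`, quasi-split frame)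
import Literature.NumberTheory.Rogawski1990.TamagawaSingularCovolumeTransport           -- ★ p844052 (W6): the (K7-s) transport
import Literature.NumberTheory.Rogawski1990.TamagawaSingularKappaBlockTransport         -- ★ p844088 (W6′): the κ-block transport
import HarnessLib

/-!
# THE S1′ ASSEMBLER (W8): `TamagawaSingularMembersExist` from (U) + S1′-fin-TF (Rogawski 1990 §14.5 Lemma 14.5.2 (b); §8.2; §1.7)

Topic `NumberTheory/Rogawski1990`; namespace `Literature.NumberTheory.Rogawski1990`.  THEOREMS ONLY (no `def`, no instance, no notation, no axiom, no named fact, no `sorry`).  Cell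
`pub/hodgecm-mathlib`, ENGINE T1 (crux H413 = `stmt-HodgeConjecture-24833`); the `stub_S1` road, brick (W8) (F0P3a-p07 (g10); LEAD F0P3a-plan (g10) WORD T9-32: «#88 ↦ {S1′-fin-TF, (U)};
(W8) assembler GO; closer edition «S1 ⟸ FIN-TF + U»»).  Count-neutral; HONEST LABEL: HC_CM is proved only modulo the printed citations until rung 0 closes — this file DERIVES the
letter S1′ from two smaller named letters and one frame hypothesis; it discharges nothing printed.

WHAT.  At every S1′ frame: (U) (★ (W4f)'s binder `hU`, closed over the carrier — an explicit HYPOTHESIS, not a named fact: review p844247) + S1′-fin-TF (`TamagawaSingularMembersFinTF …`) ⟹ `TamagawaSingularMembersExist …` (S1′ VERBATIM);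
the frames at every archimedean guard point off the centre (brick (b5)) are ★ `exists_isSingularArchFrame_of_guard` (F0P3-p03 (g11), p844172).  Proof = the CENSUS (W7) §1 plan over ★ names only: `hACS` ⟹ `νGi`, `νqi` Haar (★ (b1)); a rational diagonal frame (★ Landherr) and the quasi-split frame; (U) at that
carrier with the reference wall `z₁ = (1, e^{iπ}, 1)` and Borel σ-algebras ⟹ ★ (W4f) `exists_archSingularMembers_withData_of_universal_pinRatio` fed with `hACS`'s (W′)(W)(C)(C′G):
the built `mGis mqis TsG Tsq` with (Q-∞)(Q-q∞)(C1)-arch(C1-q)(ST-∞-s), (J-val-K-built), (W-a); S1′-fin-TF ⟹ `mGs` with (Q-fin)(C1)-fin(NORM) + (K7-s)-TF + κ-block-TF; ★ (W4g)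
(point level) and ★ (b2) (class level, through ★ (b5)) give the proportionality `mGis = K • TF`; ★ (W6) and ★ (W6′) transport (K7-s) and the κ-block from `TF` to `mGis`; the
eleven conjuncts are assembled in the letter's order ((C1) = finite half ∧ archimedean half).

* **`tamagawaSingularMembersExist_of_finTF_of_U`** — the assembler at a frame (binders = the letter's frame VERBATIM).
* **`tamagawaSingularMembersExistClosed_of_finTF_of_U`** — closed form: `(∀ L, (U) at L) → TamagawaSingularMembersFinTFClosed → TamagawaSingularMembersExistClosed` (the closer's `stub_S1 := … stub_U stub_S1finTF`, `stub_U`'s TYPE = this binder's).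

## References
* [Rogawski1990] J. D. Rogawski, *Automorphic Representations of Unitary Groups in Three Variables*, Ann. of Math. Stud. 123 (1990), §1.7 p. 6; §3.8 Prop. 3.8.1 (a) p. 27; §8.2
  Prop. 8.2.1 pp. 117–124; Prop. 10.1.2 (b) p. 146; §14.2 (14.2.1) p. 232; §14.5 Lemma 14.5.2 (b) pp. 238–239.
* [Kottwitz1988] R. E. Kottwitz, *Tamagawa numbers*, Ann. of Math. 127 (1988), Thm. 1, Prop. 2.
* [Landherr1936HermitianForms] W. Landherr, *Äquivalenz Hermitescher Formen über einem beliebigen algebraischen Zahlkörper*, Abh. Math. Sem. Hamburg 11 (1936).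
-/

set_option autoImplicit false

noncomputable section

open MeasureTheory Measure Filter Topology NumberField NumberField.InfinitePlace NumberField.mixedEmbedding Equiv Function Set IsDedekindDomain
open Literature.MeasureTheory.Group Literature.NumberTheory.Automorphic
open Literature.NumberTheory.Automorphic.UnitaryGroup hiding hermForm
open Literature.AlgebraicGeometry.ShimuraVarieties (unitaryGroup hermForm)
open Literature.LinearAlgebra.Matrix
open Literature.NumberTheory.Weil1964 Literature.NumberTheory.Weil1964.UnitaryArchTopForm
open scoped Classical Matrix MatrixGroups Matrix.Norms.Operator ContDiff NNReal ENNReal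

namespace Literature.NumberTheory.Rogawski1990

section Frame


variable (L : Type) [Field L] [NumberField L] [IsCMField L]

variable (H' : Matrix (Fin 3) (Fin 3) L) (Tinf : ArchTransferFactor L H')
    -- σ-algebras of the `G′` side (★ (O10-c5) block), of `H_v`, `G_∞`, `H_∞`, and the Haar data — EXACTLY ★ `SingularEllipticTransfer`'s binders
    [∀ g : (UnitaryGroup.cmDatum L 3 H').Adelic, MeasurableSpace ((UnitaryGroup.cmDatum L 3 H').Adelic ⧸ Subgroup.centralizer ({g} : Set (UnitaryGroup.cmDatum L 3 H').Adelic))]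
    [∀ g : (UnitaryGroup.cmDatum L 3 H').Adelic, BorelSpace ((UnitaryGroup.cmDatum L 3 H').Adelic ⧸ Subgroup.centralizer ({g} : Set (UnitaryGroup.cmDatum L 3 H').Adelic))]
    [∀ γ : UnitaryGroup.arch (↥(maximalRealSubfield L)) L (IsCMField.complexConj L) 3 H',
      MeasurableSpace (UnitaryGroup.arch (↥(maximalRealSubfield L)) L (IsCMField.complexConj L) 3 H' ⧸ Subgroup.centralizer ({γ} : Set (UnitaryGroup.arch (↥(maximalRealSubfield L)) L (IsCMField.complexConj L) 3 H')))]
    [∀ γ : UnitaryGroup.arch (↥(maximalRealSubfield L)) L (IsCMField.complexConj L) 3 H',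
      BorelSpace (UnitaryGroup.arch (↥(maximalRealSubfield L)) L (IsCMField.complexConj L) 3 H' ⧸ Subgroup.centralizer ({γ} : Set (UnitaryGroup.arch (↥(maximalRealSubfield L)) L (IsCMField.complexConj L) 3 H')))]
    [∀ (v : HeightOneSpectrum (𝓞 ↥(maximalRealSubfield L))) (γ : (UnitaryGroup.cmDatum L 3 H').Local v),
      MeasurableSpace ((UnitaryGroup.cmDatum L 3 H').Local v ⧸ Subgroup.centralizer ({γ} : Set ((UnitaryGroup.cmDatum L 3 H').Local v)))]
    [∀ (v : HeightOneSpectrum (𝓞 ↥(maximalRealSubfield L))) (γ : (UnitaryGroup.cmDatum L 3 H').Local v),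
      BorelSpace ((UnitaryGroup.cmDatum L 3 H').Local v ⧸ Subgroup.centralizer ({γ} : Set ((UnitaryGroup.cmDatum L 3 H').Local v)))]
    [∀ v : HeightOneSpectrum (𝓞 ↥(maximalRealSubfield L)), MeasurableSpace ((UnitaryGroup.cmDatum L 3 H').Local v)] [∀ v : HeightOneSpectrum (𝓞 ↥(maximalRealSubfield L)), BorelSpace ((UnitaryGroup.cmDatum L 3 H').Local v)]
    [MeasurableSpace (UnitaryGroup.cmDatum L 3 H').Adelic] [BorelSpace (UnitaryGroup.cmDatum L 3 H').Adelic]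
    [MeasurableSpace (UnitaryGroup.arch (↥(maximalRealSubfield L)) L (IsCMField.complexConj L) 3 H')] [BorelSpace (UnitaryGroup.arch (↥(maximalRealSubfield L)) L (IsCMField.complexConj L) 3 H')]
    [∀ γ : (UnitaryGroup.cmDatum L 3 H').Adelic, MeasurableSpace (↥(Subgroup.centralizer ({γ} : Set (UnitaryGroup.cmDatum L 3 H').Adelic)) ⧸
      ((UnitaryGroup.cmDatum L 3 H').quotientSubgroup ⊓ Subgroup.centralizer ({γ} : Set (UnitaryGroup.cmDatum L 3 H').Adelic)).subgroupOf (Subgroup.centralizer ({γ} : Set (UnitaryGroup.cmDatum L 3 H').Adelic)))]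
    [∀ γ : (UnitaryGroup.cmDatum L 3 H').Adelic, BorelSpace (↥(Subgroup.centralizer ({γ} : Set (UnitaryGroup.cmDatum L 3 H').Adelic)) ⧸
      ((UnitaryGroup.cmDatum L 3 H').quotientSubgroup ⊓ Subgroup.centralizer ({γ} : Set (UnitaryGroup.cmDatum L 3 H').Adelic)).subgroupOf (Subgroup.centralizer ({γ} : Set (UnitaryGroup.cmDatum L 3 H').Adelic)))]
    [hCcl : ∀ γ : (UnitaryGroup.cmDatum L 3 H').Adelic, IsClosed ((Subgroup.centralizer ({γ} : Set (UnitaryGroup.cmDatum L 3 H').Adelic) : Subgroup (UnitaryGroup.cmDatum L 3 H').Adelic) : Set (UnitaryGroup.cmDatum L 3 H').Adelic)]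
    [∀ γ : (UnitaryGroup.cmDatum L 3 H').Adelic, (count : Measure ↥(((UnitaryGroup.cmDatum L 3 H').quotientSubgroup ⊓ Subgroup.centralizer ({γ} : Set (UnitaryGroup.cmDatum L 3 H').Adelic)).subgroupOf
      (Subgroup.centralizer ({γ} : Set (UnitaryGroup.cmDatum L 3 H').Adelic)))).IsHaarMeasure]
    [∀ v : HeightOneSpectrum (𝓞 ↥(maximalRealSubfield L)), MeasurableSpace ((UnitaryGroup.cmDatum L 2 (Matrix.of fun i j : Fin 2 => if i.val + j.val + 1 = 2 then (1 : L) else 0)).Local v ×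
        (UnitaryGroup.cmDatum L 1 (Matrix.of fun i j : Fin 1 => if i.val + j.val + 1 = 1 then (1 : L) else 0)).Local v)]
    [∀ v : HeightOneSpectrum (𝓞 ↥(maximalRealSubfield L)), BorelSpace ((UnitaryGroup.cmDatum L 2 (Matrix.of fun i j : Fin 2 => if i.val + j.val + 1 = 2 then (1 : L) else 0)).Local v ×
        (UnitaryGroup.cmDatum L 1 (Matrix.of fun i j : Fin 1 => if i.val + j.val + 1 = 1 then (1 : L) else 0)).Local v)]
    [∀ (v : HeightOneSpectrum (𝓞 ↥(maximalRealSubfield L))) (a : ((UnitaryGroup.cmDatum L 2 (Matrix.of fun i j : Fin 2 => if i.val + j.val + 1 = 2 then (1 : L) else 0)).Local v ×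
        (UnitaryGroup.cmDatum L 1 (Matrix.of fun i j : Fin 1 => if i.val + j.val + 1 = 1 then (1 : L) else 0)).Local v)),
      MeasurableSpace (((UnitaryGroup.cmDatum L 2 (Matrix.of fun i j : Fin 2 => if i.val + j.val + 1 = 2 then (1 : L) else 0)).Local v ×
        (UnitaryGroup.cmDatum L 1 (Matrix.of fun i j : Fin 1 => if i.val + j.val + 1 = 1 then (1 : L) else 0)).Local v) ⧸ Subgroup.centralizer ({a} : Set ((UnitaryGroup.cmDatum L 2 (Matrix.of fun i j : Fin 2 => if i.val + j.val + 1 = 2 then (1 : L) else 0)).Local v ×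
        (UnitaryGroup.cmDatum L 1 (Matrix.of fun i j : Fin 1 => if i.val + j.val + 1 = 1 then (1 : L) else 0)).Local v)))]
    [∀ (v : HeightOneSpectrum (𝓞 ↥(maximalRealSubfield L))) (a : ((UnitaryGroup.cmDatum L 2 (Matrix.of fun i j : Fin 2 => if i.val + j.val + 1 = 2 then (1 : L) else 0)).Local v ×
        (UnitaryGroup.cmDatum L 1 (Matrix.of fun i j : Fin 1 => if i.val + j.val + 1 = 1 then (1 : L) else 0)).Local v)),
      BorelSpace (((UnitaryGroup.cmDatum L 2 (Matrix.of fun i j : Fin 2 => if i.val + j.val + 1 = 2 then (1 : L) else 0)).Local v ×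
        (UnitaryGroup.cmDatum L 1 (Matrix.of fun i j : Fin 1 => if i.val + j.val + 1 = 1 then (1 : L) else 0)).Local v) ⧸ Subgroup.centralizer ({a} : Set ((UnitaryGroup.cmDatum L 2 (Matrix.of fun i j : Fin 2 => if i.val + j.val + 1 = 2 then (1 : L) else 0)).Local v ×
        (UnitaryGroup.cmDatum L 1 (Matrix.of fun i j : Fin 1 => if i.val + j.val + 1 = 1 then (1 : L) else 0)).Local v)))]
    [MeasurableSpace (UnitaryGroup.arch (↥(maximalRealSubfield L)) L (IsCMField.complexConj L) 3 (Matrix.of fun i j : Fin 3 => if i.val + j.val + 1 = 3 then (1 : L) else 0))] [BorelSpace (UnitaryGroup.arch (↥(maximalRealSubfield L)) L (IsCMField.complexConj L) 3 (Matrix.of fun i j : Fin 3 => if i.val + j.val + 1 = 3 then (1 : L) else 0))]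
    [∀ γ : UnitaryGroup.arch (↥(maximalRealSubfield L)) L (IsCMField.complexConj L) 3 (Matrix.of fun i j : Fin 3 => if i.val + j.val + 1 = 3 then (1 : L) else 0),
      MeasurableSpace (UnitaryGroup.arch (↥(maximalRealSubfield L)) L (IsCMField.complexConj L) 3 (Matrix.of fun i j : Fin 3 => if i.val + j.val + 1 = 3 then (1 : L) else 0) ⧸ Subgroup.centralizer ({γ} : Set (UnitaryGroup.arch (↥(maximalRealSubfield L)) L (IsCMField.complexConj L) 3 (Matrix.of fun i j : Fin 3 => if i.val + j.val + 1 = 3 then (1 : L) else 0))))]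
    [∀ γ : UnitaryGroup.arch (↥(maximalRealSubfield L)) L (IsCMField.complexConj L) 3 (Matrix.of fun i j : Fin 3 => if i.val + j.val + 1 = 3 then (1 : L) else 0),
      BorelSpace (UnitaryGroup.arch (↥(maximalRealSubfield L)) L (IsCMField.complexConj L) 3 (Matrix.of fun i j : Fin 3 => if i.val + j.val + 1 = 3 then (1 : L) else 0) ⧸ Subgroup.centralizer ({γ} : Set (UnitaryGroup.arch (↥(maximalRealSubfield L)) L (IsCMField.complexConj L) 3 (Matrix.of fun i j : Fin 3 => if i.val + j.val + 1 = 3 then (1 : L) else 0))))]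
    [MeasurableSpace (UnitaryGroup.arch (↥(maximalRealSubfield L)) L (IsCMField.complexConj L) 2 (Matrix.of fun i j : Fin 2 => if i.val + j.val + 1 = 2 then (1 : L) else 0) ×
          UnitaryGroup.arch (↥(maximalRealSubfield L)) L (IsCMField.complexConj L) 1 (Matrix.of fun i j : Fin 1 => if i.val + j.val + 1 = 1 then (1 : L) else 0))]
    [BorelSpace (UnitaryGroup.arch (↥(maximalRealSubfield L)) L (IsCMField.complexConj L) 2 (Matrix.of fun i j : Fin 2 => if i.val + j.val + 1 = 2 then (1 : L) else 0) ×
          UnitaryGroup.arch (↥(maximalRealSubfield L)) L (IsCMField.complexConj L) 1 (Matrix.of fun i j : Fin 1 => if i.val + j.val + 1 = 1 then (1 : L) else 0))]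
    [∀ a : (UnitaryGroup.arch (↥(maximalRealSubfield L)) L (IsCMField.complexConj L) 2 (Matrix.of fun i j : Fin 2 => if i.val + j.val + 1 = 2 then (1 : L) else 0) ×
          UnitaryGroup.arch (↥(maximalRealSubfield L)) L (IsCMField.complexConj L) 1 (Matrix.of fun i j : Fin 1 => if i.val + j.val + 1 = 1 then (1 : L) else 0)),
      MeasurableSpace ((UnitaryGroup.arch (↥(maximalRealSubfield L)) L (IsCMField.complexConj L) 2 (Matrix.of fun i j : Fin 2 => if i.val + j.val + 1 = 2 then (1 : L) else 0) ×
          UnitaryGroup.arch (↥(maximalRealSubfield L)) L (IsCMField.complexConj L) 1 (Matrix.of fun i j : Fin 1 => if i.val + j.val + 1 = 1 then (1 : L) else 0)) ⧸ Subgroup.centralizer ({a} : Set (UnitaryGroup.arch (↥(maximalRealSubfield L)) L (IsCMField.complexConj L) 2 (Matrix.of fun i j : Fin 2 => if i.val + j.val + 1 = 2 then (1 : L) else 0) ×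
          UnitaryGroup.arch (↥(maximalRealSubfield L)) L (IsCMField.complexConj L) 1 (Matrix.of fun i j : Fin 1 => if i.val + j.val + 1 = 1 then (1 : L) else 0))))]
    [∀ a : (UnitaryGroup.arch (↥(maximalRealSubfield L)) L (IsCMField.complexConj L) 2 (Matrix.of fun i j : Fin 2 => if i.val + j.val + 1 = 2 then (1 : L) else 0) ×
          UnitaryGroup.arch (↥(maximalRealSubfield L)) L (IsCMField.complexConj L) 1 (Matrix.of fun i j : Fin 1 => if i.val + j.val + 1 = 1 then (1 : L) else 0)),
      BorelSpace ((UnitaryGroup.arch (↥(maximalRealSubfield L)) L (IsCMField.complexConj L) 2 (Matrix.of fun i j : Fin 2 => if i.val + j.val + 1 = 2 then (1 : L) else 0) ×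
          UnitaryGroup.arch (↥(maximalRealSubfield L)) L (IsCMField.complexConj L) 1 (Matrix.of fun i j : Fin 1 => if i.val + j.val + 1 = 1 then (1 : L) else 0)) ⧸ Subgroup.centralizer ({a} : Set (UnitaryGroup.arch (↥(maximalRealSubfield L)) L (IsCMField.complexConj L) 2 (Matrix.of fun i j : Fin 2 => if i.val + j.val + 1 = 2 then (1 : L) else 0) ×
          UnitaryGroup.arch (↥(maximalRealSubfield L)) L (IsCMField.complexConj L) 1 (Matrix.of fun i j : Fin 1 => if i.val + j.val + 1 = 1 then (1 : L) else 0))))]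
    (νH : ∀ v : HeightOneSpectrum (𝓞 ↥(maximalRealSubfield L)), Measure ((UnitaryGroup.cmDatum L 2 (Matrix.of fun i j : Fin 2 => if i.val + j.val + 1 = 2 then (1 : L) else 0)).Local v ×
        (UnitaryGroup.cmDatum L 1 (Matrix.of fun i j : Fin 1 => if i.val + j.val + 1 = 1 then (1 : L) else 0)).Local v))
    (νG : ∀ v : HeightOneSpectrum (𝓞 ↥(maximalRealSubfield L)), Measure ((UnitaryGroup.cmDatum L 3 H').Local v))
    [∀ v, IsFiniteMeasureOnCompacts (νH v)] [∀ v, (νH v).IsMulRightInvariant]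
    [∀ v, (νG v).IsHaarMeasure] [∀ v, (νG v).IsMulRightInvariant]  -- MAIN-b's strength (F2): `νG_v` Haar
    (νGi : Measure (UnitaryGroup.arch (↥(maximalRealSubfield L)) L (IsCMField.complexConj L) 3 H')) (νqi : Measure (UnitaryGroup.arch (↥(maximalRealSubfield L)) L (IsCMField.complexConj L) 3 (Matrix.of fun i j : Fin 3 => if i.val + j.val + 1 = 3 then (1 : L) else 0)))
    (νHi : Measure (UnitaryGroup.arch (↥(maximalRealSubfield L)) L (IsCMField.complexConj L) 2 (Matrix.of fun i j : Fin 2 => if i.val + j.val + 1 = 2 then (1 : L) else 0) ×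
          UnitaryGroup.arch (↥(maximalRealSubfield L)) L (IsCMField.complexConj L) 1 (Matrix.of fun i j : Fin 1 => if i.val + j.val + 1 = 1 then (1 : L) else 0)))
    [IsFiniteMeasureOnCompacts νGi] [νGi.IsMulRightInvariant] [IsFiniteMeasureOnCompacts νqi] [νqi.IsMulRightInvariant]
    [IsFiniteMeasureOnCompacts νHi] [νHi.IsMulRightInvariant]
    (νA : Measure (UnitaryGroup.cmDatum L 3 H').Adelic) [νA.IsHaarMeasure] [νA.IsMulRightInvariant]


set_option maxHeartbeats 400000 in
/-- **THE S1′ ASSEMBLER.**  At every S1′ frame: the universal pin ratio (U) (hypothesis `hU` = ★ (W4f)'s binder closed over `α′`, `z₁`, σ-algebras; `∃ K`) and S1′-fin-TF (`TamagawaSingularMembersFinTF …`) imply `TamagawaSingularMembersExist …` VERBATIM — the witness is `(mGs, mGis, mqis)` with `mGs` from S1′-fin-TF and `mGis, mqis` BUILT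
by the (ST-∞) road (★ (W4f)); (K7-s) and the κ-block are TRANSPORTED from the top-form family (★ (W6), ★ (W6′)) along `mGis = K • TF` (★ (W4g), ★ (b2) with the frames ★ (b5)).  Print: Lemma 14.5.2 (b)
[Rogawski1990 pp. 238–239] = (its finite∕Tamagawa half, S1′-fin-TF) + (its archimedean half, PROVED in-house up to the pin ratio (U) of §8.2).
[cite: Rogawski1990, §14.5 Lemma 14.5.2 (b) pp. 238–239; §8.2 Prop. 8.2.1 pp. 117–124; §1.7 p. 6] [cite: Kottwitz1988, Thm. 1, Prop. 2] -/
theorem tamagawaSingularMembersExist_of_finTF_of_U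
    -- (U): ★ (W4f) p844053's binder `hU` BODY VERBATIM, closed over the carrier `α′`, the reference wall `z₁` and the σ-algebras it reads, ONE constant `K` per instance
    (hU : ∀ [MeasurableSpace (GL (Fin 3) ℂ)] [BorelSpace (GL (Fin 3) ℂ)]
      (α' : Fin 3 → L) (_hα' : ∀ i, α' i ≠ 0) (_hhermα : ∀ i, (IsCMField.complexConj L (α' i) : L) = α' i)
      [MeasurableSpace (arch (↥(maximalRealSubfield L)) L (IsCMField.complexConj L) 3 (Matrix.diagonal α'))] [BorelSpace (arch (↥(maximalRealSubfield L)) L (IsCMField.complexConj L) 3 (Matrix.diagonal α'))]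
      (z₁ : {w : InfinitePlace L // IsComplex w} → Fin 3 → Circle) (h02 : ∀ w, z₁ w 0 = z₁ w 2) (h01 : ∀ w, z₁ w 0 ≠ z₁ w 1)
      [∀ (w : {w : InfinitePlace L // IsComplex w}) (τ : Perm (Fin 3)), MeasurableSpace (archLocal L 3 (Matrix.diagonal (α' ∘ ⇑τ)) w ⧸ Subgroup.centralizer ({(⟨circleDiagonal 3 (z₁ w), circleDiagonal_mem_archLocal_diagonal L 3 (α' ∘ ⇑τ) w (z₁ w)⟩ : archLocal L 3 (Matrix.diagonal (α' ∘ ⇑τ)) w)} : Set (archLocal L 3 (Matrix.diagonal (α' ∘ ⇑τ)) w)))]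
      [∀ (w : {w : InfinitePlace L // IsComplex w}) (τ : Perm (Fin 3)), BorelSpace (archLocal L 3 (Matrix.diagonal (α' ∘ ⇑τ)) w ⧸ Subgroup.centralizer ({(⟨circleDiagonal 3 (z₁ w), circleDiagonal_mem_archLocal_diagonal L 3 (α' ∘ ⇑τ) w (z₁ w)⟩ : archLocal L 3 (Matrix.diagonal (α' ∘ ⇑τ)) w)} : Set (archLocal L 3 (Matrix.diagonal (α' ∘ ⇑τ)) w)))],
      ∃ K : ℝ≥0, K ≠ 0 ∧
      ∀ (νH : ∀ (w : {w : InfinitePlace L // IsComplex w}) (τ : Perm (Fin 3)), Measure (Subgroup.centralizer ({(⟨circleDiagonal 3 (z₁ w), circleDiagonal_mem_archLocal_diagonal L 3 (α' ∘ ⇑τ) w (z₁ w)⟩ : archLocal L 3 (Matrix.diagonal (α' ∘ ⇑τ)) w)} : Set (archLocal L 3 (Matrix.diagonal (α' ∘ ⇑τ)) w))))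
      (hνH : ∀ w τ, (νH w τ).IsHaarMeasure ∧ (νH w τ).IsInvInvariant)
      (hpin : ∀ (w : {w : InfinitePlace L // IsComplex w}) (τ : Perm (Fin 3)), (w.1.embedding (α' (τ 0))).re * (w.1.embedding (α' (τ 2))).re < 0 →
      haveI : LocallyCompactSpace (archLocal L 3 (Matrix.diagonal (α' ∘ ⇑τ)) w) := locallyCompactSpace_archLocal L 3 (Matrix.diagonal (α' ∘ ⇑τ)) w
      haveI : SecondCountableTopology (archLocal L 3 (Matrix.diagonal (α' ∘ ⇑τ)) w) := secondCountableTopology_archLocal L 3 (Matrix.diagonal (α' ∘ ⇑τ)) w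
      haveI : (νH w τ).IsHaarMeasure := (hνH w τ).1
      haveI : (νH w τ).IsInvInvariant := (hνH w τ).2
      ∃ (ν : Measure (archLocal L 3 (Matrix.diagonal (α' ∘ ⇑τ)) w)) (_ : ν.IsHaarMeasure) (_ : ν.IsMulRightInvariant),
      ∀ (Θ : Matrix (Fin 3) (Fin 3) ℂ → ℂ), ContDiff ℝ (⊤ : ℕ∞) Θ →
      HasCompactSupport (fun k : archLocal L 3 (Matrix.diagonal (α' ∘ ⇑τ)) w => Θ ((k : GL (Fin 3) ℂ) : Matrix (Fin 3) (Fin 3) ℂ)) →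
      ∀ (z₀ : Fin 3 → Circle) (h02' : z₀ 0 = z₀ 2) (h01' : z₀ 0 ≠ z₀ 1),
      Tendsto (fun ψ : ℝ => deriv (fun ψ : ℝ => (2 * Real.sin ψ : ℂ) *
      ∫ g, Θ (((g * ⟨circleDiagonal 3 (fun i => z₀ i * Circle.exp (![(1 : ℝ), 0, -1] i * ψ)),
      circleDiagonal_mem_archLocal_diagonal L 3 (α' ∘ ⇑τ) w _⟩ * g⁻¹ : archLocal L 3 (Matrix.diagonal (α' ∘ ⇑τ)) w) : GL (Fin 3) ℂ) : Matrix (Fin 3) (Fin 3) ℂ) ∂(ν)) ψ)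
      (𝓝[≠] 0)
      (𝓝 ((-1 : ℂ) * ∫ y, descConj (⟨circleDiagonal 3 z₀, circleDiagonal_mem_archLocal_diagonal L 3 (α' ∘ ⇑τ) w z₀⟩ : archLocal L 3 (Matrix.diagonal (α' ∘ ⇑τ)) w)
      (Subgroup.centralizer ({(⟨circleDiagonal 3 (z₁ w), circleDiagonal_mem_archLocal_diagonal L 3 (α' ∘ ⇑τ) w (z₁ w)⟩ : archLocal L 3 (Matrix.diagonal (α' ∘ ⇑τ)) w)} : Set (archLocal L 3 (Matrix.diagonal (α' ∘ ⇑τ)) w)))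
      (forall_mem_centralizer_circleDiagonal_comm_of_wall L (α' ∘ ⇑τ) w (h02 w) (h01 w) h02' h01')
      (fun k : archLocal L 3 (Matrix.diagonal (α' ∘ ⇑τ)) w => Θ ((k : GL (Fin 3) ℂ) : Matrix (Fin 3) (Fin 3) ℂ)) y
      ∂(quotientMeasure _ (νH w τ) (isClosed_coe_centralizer_singleton _) (ν)))))
      (z : {w : InfinitePlace L // IsComplex w} → Fin 3 → Circle) (hwall : ∀ w, z w 0 = z w 2 ∧ z w 0 ≠ z w 1)
      (_hrat : ∃ a b : L, ∀ w : {w : InfinitePlace L // IsComplex w}, ((z w 0 : ℂ) = w.1.embedding a) ∧ ((z w 1 : ℂ) = w.1.embedding b))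
      (ρ : {w : InfinitePlace L // IsComplex w} → Perm (Fin 3))
      (ρZ : ∀ (w : {w : InfinitePlace L // IsComplex w}) (σ : Perm (Fin 3)), Measure (Subgroup.centralizer ({(⟨circleDiagonal 3 (z w ∘ ⇑σ), circleDiagonal_mem_archLocal_diagonal L 3 α' w (z w ∘ ⇑σ)⟩ : archLocal L 3 (Matrix.diagonal α') w)} : Set (archLocal L 3 (Matrix.diagonal α') w))))
      (_hρZi : ∀ w σ, (ρZ w σ).IsHaarMeasure ∧ (ρZ w σ).IsInvInvariant)
      (_hρZ : ∀ (w : {w : InfinitePlace L // IsComplex w}) (σ : Perm (Fin 3)), ¬ 0 < (w.1.embedding (α' (σ⁻¹ 0))).re * (w.1.embedding (α' (σ⁻¹ 2))).re →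
      ρZ w σ = (νH w σ⁻¹).map (subgroupCongrHomeomorph (ContinuousMulEquiv.restrictSubgroup (GLn.conjEquiv (Matrix.GeneralLinearGroup.mkOfDetNeZero _ (det_monomial_one_ne_zero 3 σ⁻¹))) (archLocal L 3 (Matrix.diagonal (α' ∘ ⇑σ⁻¹)) w) (archLocal L 3 (Matrix.diagonal α') w) (mem_archLocal_comp_perm_iff_conj_mem L 3 α' w σ⁻¹)).toMulEquiv
      (Subgroup.centralizer ({(⟨circleDiagonal 3 (z₁ w), circleDiagonal_mem_archLocal_diagonal L 3 (α' ∘ ⇑σ⁻¹) w (z₁ w)⟩ : archLocal L 3 (Matrix.diagonal (α' ∘ ⇑σ⁻¹)) w)} : Set (archLocal L 3 (Matrix.diagonal (α' ∘ ⇑σ⁻¹)) w)))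
      (Subgroup.centralizer ({(⟨circleDiagonal 3 (z w ∘ ⇑σ), circleDiagonal_mem_archLocal_diagonal L 3 α' w (z w ∘ ⇑σ)⟩ : archLocal L 3 (Matrix.diagonal α') w)} : Set (archLocal L 3 (Matrix.diagonal α') w)))
      (relabel_inv_mem_centralizer_circleDiagonal_comp_iff L α' w σ (h02 w) (h01 w) (hwall w).1 (hwall w).2)
      (ContinuousMulEquiv.restrictSubgroup (GLn.conjEquiv (Matrix.GeneralLinearGroup.mkOfDetNeZero _ (det_monomial_one_ne_zero 3 σ⁻¹))) (archLocal L 3 (Matrix.diagonal (α' ∘ ⇑σ⁻¹)) w) (archLocal L 3 (Matrix.diagonal α') w) (mem_archLocal_comp_perm_iff_conj_mem L 3 α' w σ⁻¹)).continuous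
      (ContinuousMulEquiv.restrictSubgroup (GLn.conjEquiv (Matrix.GeneralLinearGroup.mkOfDetNeZero _ (det_monomial_one_ne_zero 3 σ⁻¹))) (archLocal L 3 (Matrix.diagonal (α' ∘ ⇑σ⁻¹)) w) (archLocal L 3 (Matrix.diagonal α') w) (mem_archLocal_comp_perm_iff_conj_mem L 3 α' w σ⁻¹)).symm.continuous))
      (_hρZ1 : ∀ (w : {w : InfinitePlace L // IsComplex w}) (σ : Perm (Fin 3)), 0 < (w.1.embedding (α' (σ⁻¹ 0))).re * (w.1.embedding (α' (σ⁻¹ 2))).re → ρZ w σ Set.univ = 1)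
      (ρP : Measure (Subgroup.pi Set.univ (fun w : {w : InfinitePlace L // IsComplex w} => Subgroup.centralizer ({(⟨circleDiagonal 3 (z w ∘ ⇑(ρ w)), circleDiagonal_mem_archLocal_diagonal L 3 α' w (z w ∘ ⇑(ρ w))⟩ : archLocal L 3 (Matrix.diagonal α') w)} : Set (archLocal L 3 (Matrix.diagonal α') w)))))
      (_hρP : Measure.map (subgroupPiCoords fun w : {w : InfinitePlace L // IsComplex w} => Subgroup.centralizer ({(⟨circleDiagonal 3 (z w ∘ ⇑(ρ w)), circleDiagonal_mem_archLocal_diagonal L 3 α' w (z w ∘ ⇑(ρ w))⟩ : archLocal L 3 (Matrix.diagonal α') w)} : Set (archLocal L 3 (Matrix.diagonal α') w))) ρP = Measure.pi fun w => ρZ w (ρ w))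
      (ρ' : Measure (Subgroup.centralizer ({archDiagTorus L 3 α' (fun w => z w ∘ ⇑(ρ w))} : Set (arch (↥(maximalRealSubfield L)) L (IsCMField.complexConj L) 3 (Matrix.diagonal α')))))
      (_hρ' : ρ' = ρP.map (subgroupCongrHomeomorph (archPiEquivCM 3 L (Matrix.diagonal α')).symm.toMulEquiv (Subgroup.pi Set.univ (fun w : {w : InfinitePlace L // IsComplex w} => Subgroup.centralizer ({(⟨circleDiagonal 3 (z w ∘ ⇑(ρ w)), circleDiagonal_mem_archLocal_diagonal L 3 α' w (z w ∘ ⇑(ρ w))⟩ : archLocal L 3 (Matrix.diagonal α') w)} : Set (archLocal L 3 (Matrix.diagonal α') w)))) (Subgroup.centralizer ({archDiagTorus L 3 α' (fun w => z w ∘ ⇑(ρ w))} : Set (arch (↥(maximalRealSubfield L)) L (IsCMField.complexConj L) 3 (Matrix.diagonal α')))) (apply_mem_centralizer_iff_mem_pi_centralizer _ (archPiEquivCM 3 L (Matrix.diagonal α')).symm.toMulEquiv (archPiEquivCM_symm_circleDiagonal_eq_archDiagTorus L 3 α' (fun w => z w ∘ ⇑(ρ w)))) (archPiEquivCM 3 L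 (Matrix.diagonal α')).symm.continuous (archPiEquivCM 3 L (Matrix.diagonal α')).continuous)),
      centralizerTopFormHaar L (Matrix.diagonal α') (archDiagTorus L 3 α' (fun w => z w ∘ ⇑(ρ w))) = K • ρ')
    (hfin : TamagawaSingularMembersFinTF L H' Tinf νH νG νGi νqi νHi νA) :
    TamagawaSingularMembersExist L H' Tinf νH νG νGi νqi νHi νA := by
  classical
  intro hanis Sbad Δ mH mG m' m mHi t' t tH hherm hCTM hACS
  -- (b1): the archimedean Haar data ARE Haar
  haveI : νGi.IsHaarMeasure := isHaarMeasure_of_archCanonicalSingularMatrix L H' Tinf νGi νqi νHi hanis m' m mHi t' t tH hherm hACS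
  haveI : νqi.IsHaarMeasure := isHaarMeasure_quasiSplit_of_archCanonicalSingularMatrix L H' Tinf νGi νqi νHi hanis m' m mHi t' t tH hACS
  have hd' : H'.det ≠ 0 := Godement.det_ne_zero_of_anisotropic L H' hanis
  have hd₃ : (Matrix.of fun i j : Fin 3 => if i.val + j.val + 1 = 3 then (1 : L) else 0).det ≠ 0 := (isUnit_antidiagOne_det L 3).ne_zero
  -- the regular archimedean Weil data of the frame, from `hACS`
  have hW' := hACS.2.2.2.2.2.2.1
  have hW := hACS.2.2.2.2.2.2.2.1
  have hC := hACS.2.2.2.2.2.2.2.2.2.2.1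
  have hC'G := hACS.2.2.2.2.2.2.2.2.2.2.2.1
  -- a rational diagonal frame of `H′` and the quasi-split frame of `Φ₃`
  obtain ⟨α', P, hP, hα', hhermα⟩ := exists_rational_diagonal_frame L H' hherm hd'
  -- the σ-algebras (U) reads at the carrier `α′` and the reference wall `z₁ = (1, e^{iπ}, 1)`
  letI iGL : MeasurableSpace (GL (Fin 3) ℂ) := borel _
  haveI iGLb : BorelSpace (GL (Fin 3) ℂ) := ⟨rfl⟩
  letI iAA : MeasurableSpace (UnitaryGroup.arch (↥(maximalRealSubfield L)) L (IsCMField.complexConj L) 3 (Matrix.diagonal α')) := borel _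
  haveI iAAb : BorelSpace (UnitaryGroup.arch (↥(maximalRealSubfield L)) L (IsCMField.complexConj L) 3 (Matrix.diagonal α')) := ⟨rfl⟩
  let z₁ : {w : InfinitePlace L // IsComplex w} → Fin 3 → Circle := fun _ => ![1, Circle.exp Real.pi, 1]
  have h02 : ∀ w, z₁ w 0 = z₁ w 2 := fun _ => rfl
  have h01 : ∀ w, z₁ w 0 ≠ z₁ w 1 := by
    intro w h
    have h' := congrArg (fun u : Circle => (u : ℂ)) h
    simp only [z₁, Matrix.cons_val_zero, Matrix.cons_val_one, Circle.coe_one, Circle.coe_exp, Complex.exp_pi_mul_I] at h'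
    norm_num at h'
  letI iRA : ∀ (w : {w : InfinitePlace L // IsComplex w}) (τ : Perm (Fin 3)), MeasurableSpace (archLocal L 3 (Matrix.diagonal (α' ∘ ⇑τ)) w ⧸ Subgroup.centralizer
      ({(⟨circleDiagonal 3 (z₁ w), circleDiagonal_mem_archLocal_diagonal L 3 (α' ∘ ⇑τ) w (z₁ w)⟩ : archLocal L 3 (Matrix.diagonal (α' ∘ ⇑τ)) w)} : Set (archLocal L 3 (Matrix.diagonal (α' ∘ ⇑τ)) w))) :=
    fun _ _ => borel _
  haveI iRAb : ∀ (w : {w : InfinitePlace L // IsComplex w}) (τ : Perm (Fin 3)), BorelSpace (archLocal L 3 (Matrix.diagonal (α' ∘ ⇑τ)) w ⧸ Subgroup.centralizer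
      ({(⟨circleDiagonal 3 (z₁ w), circleDiagonal_mem_archLocal_diagonal L 3 (α' ∘ ⇑τ) w (z₁ w)⟩ : archLocal L 3 (Matrix.diagonal (α' ∘ ⇑τ)) w)} : Set (archLocal L 3 (Matrix.diagonal (α' ∘ ⇑τ)) w))) :=
    fun _ _ => ⟨rfl⟩
  obtain ⟨K, hK0, hUα⟩ := hU α' hα' hhermα z₁ h02 h01
  -- ★ (W4f): the built archimedean members with their data, (J-val-K-built) and (W-a)
  obtain ⟨mGis, mqis, TsG, Tsq, hQG, hQq, -, -, hC1a, hC1q, hST, hJ, hWa⟩ :=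
    exists_archSingularMembers_withData_of_universal_pinRatio L H' hherm hanis α' P hP hα' hhermα z₁ h02 h01 K hK0 hUα
      ![(2 : L)⁻¹, 1, -(2 : L)⁻¹] (Matrix.GeneralLinearGroup.mkOfDetNeZero !![(1 : L), 0, 1; 0, 1, 0; 1, 0, -1] (det_quasiSplitFrame_ne_zero L)) (formCongr_quasiSplitFrame_diagonal L)
      (quasiSplitWeights_ne_zero L) (fun i => cmConjRingHom_quasiSplitWeights L i) νGi νqi t' t hd' hd₃ hC hC'G m' m hW' hW
  -- (R2): the finite members with (K7-s)-TF and the κ-block for the top-form family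
  obtain ⟨mGs, hQfin, hC1fin, hNORM, hK7TF, hκTF⟩ := hfin hanis Sbad Δ mH mG m' m mHi t' t tH hherm hCTM hACS
  -- the proportionality `mGis = K • TF`: point level (★ (W4g)) and class level (★ (b2), through the frames ★ (b5))
  have hKpt := atPoint_archPart_toAdelic_eq_smul_of_pinRatio_export L H' hherm hanis νGi hWa
  have hKcl := eq_smul_archSingularTopFormFamily_of_pinRatio L H' νGi hQG K hK0 hJ fun x hx hnc => exists_isSingularArchFrame_of_guard L H' hherm hanis hx hnc
  refine ⟨mGs, mGis, mqis, hQfin, ⟨νGi, inferInstance, inferInstance, TsG, hQG⟩, ⟨νqi, inferInstance, inferInstance, Tsq, hQq⟩,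
    fun c hc => ⟨hC1fin c hc, hC1a c hc⟩, hC1q, hNORM, ?_, hST, ?_⟩
  · exact tamagawaSingularCovolume_transport_of_atPoint_eq_smul L H' νA mGs mGis _ K hK0 hKpt hK7TF
  · exact tamagawaSingularKappaBlock_transport_of_eq_smul L H' Tinf Δ mH mG m' mHi mGs mGis _ K hK0 hKcl hκTF

end Frame

set_option maxHeartbeats 400000 in
/-- **THE S1′ ASSEMBLER, CLOSED FORM** — the shape the closer edition «S1 ⟸ FIN-TF + U» reads: `stub_S1 := tamagawaSingularMembersExistClosed_of_finTF_of_U stub_U stub_S1finTF`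
((U) closed over `L` like `stub_L21`; `stub_U`'s registered TYPE is this theorem's `hU` binder — (U) is NOT a Literature fact (review p844247: it is the project's pin-ratio hypothesis, dischargeable in-house by the D-T road), so it stays an explicit binder here).
[cite: Rogawski1990, §14.5 Lemma 14.5.2 (b) pp. 238–239; §8.2 Prop. 8.2.1 pp. 117–124; §1.7 p. 6] [cite: Kottwitz1988, Thm. 1, Prop. 2] -/
theorem tamagawaSingularMembersExistClosed_of_finTF_of_U
    (hU : ∀ (L : Type) [Field L] [NumberField L] [IsCMField L],
      ∀ [MeasurableSpace (GL (Fin 3) ℂ)] [BorelSpace (GL (Fin 3) ℂ)]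
      (α' : Fin 3 → L) (_hα' : ∀ i, α' i ≠ 0) (_hhermα : ∀ i, (IsCMField.complexConj L (α' i) : L) = α' i)
      [MeasurableSpace (arch (↥(maximalRealSubfield L)) L (IsCMField.complexConj L) 3 (Matrix.diagonal α'))] [BorelSpace (arch (↥(maximalRealSubfield L)) L (IsCMField.complexConj L) 3 (Matrix.diagonal α'))]
      (z₁ : {w : InfinitePlace L // IsComplex w} → Fin 3 → Circle) (h02 : ∀ w, z₁ w 0 = z₁ w 2) (h01 : ∀ w, z₁ w 0 ≠ z₁ w 1)
      [∀ (w : {w : InfinitePlace L // IsComplex w}) (τ : Perm (Fin 3)), MeasurableSpace (archLocal L 3 (Matrix.diagonal (α' ∘ ⇑τ)) w ⧸ Subgroup.centralizer ({(⟨circleDiagonal 3 (z₁ w), circleDiagonal_mem_archLocal_diagonal L 3 (α' ∘ ⇑τ) w (z₁ w)⟩ : archLocal L 3 (Matrix.diagonal (α' ∘ ⇑τ)) w)} : Set (archLocal L 3 (Matrix.diagonal (α' ∘ ⇑τ)) w)))]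
      [∀ (w : {w : InfinitePlace L // IsComplex w}) (τ : Perm (Fin 3)), BorelSpace (archLocal L 3 (Matrix.diagonal (α' ∘ ⇑τ)) w ⧸ Subgroup.centralizer ({(⟨circleDiagonal 3 (z₁ w), circleDiagonal_mem_archLocal_diagonal L 3 (α' ∘ ⇑τ) w (z₁ w)⟩ : archLocal L 3 (Matrix.diagonal (α' ∘ ⇑τ)) w)} : Set (archLocal L 3 (Matrix.diagonal (α' ∘ ⇑τ)) w)))],
      ∃ K : ℝ≥0, K ≠ 0 ∧
      ∀ (νH : ∀ (w : {w : InfinitePlace L // IsComplex w}) (τ : Perm (Fin 3)), Measure (Subgroup.centralizer ({(⟨circleDiagonal 3 (z₁ w), circleDiagonal_mem_archLocal_diagonal L 3 (α' ∘ ⇑τ) w (z₁ w)⟩ : archLocal L 3 (Matrix.diagonal (α' ∘ ⇑τ)) w)} : Set (archLocal L 3 (Matrix.diagonal (α' ∘ ⇑τ)) w))))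
      (hνH : ∀ w τ, (νH w τ).IsHaarMeasure ∧ (νH w τ).IsInvInvariant)
      (hpin : ∀ (w : {w : InfinitePlace L // IsComplex w}) (τ : Perm (Fin 3)), (w.1.embedding (α' (τ 0))).re * (w.1.embedding (α' (τ 2))).re < 0 →
      haveI : LocallyCompactSpace (archLocal L 3 (Matrix.diagonal (α' ∘ ⇑τ)) w) := locallyCompactSpace_archLocal L 3 (Matrix.diagonal (α' ∘ ⇑τ)) w
      haveI : SecondCountableTopology (archLocal L 3 (Matrix.diagonal (α' ∘ ⇑τ)) w) := secondCountableTopology_archLocal L 3 (Matrix.diagonal (α' ∘ ⇑τ)) w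
      haveI : (νH w τ).IsHaarMeasure := (hνH w τ).1
      haveI : (νH w τ).IsInvInvariant := (hνH w τ).2
      ∃ (ν : Measure (archLocal L 3 (Matrix.diagonal (α' ∘ ⇑τ)) w)) (_ : ν.IsHaarMeasure) (_ : ν.IsMulRightInvariant),
      ∀ (Θ : Matrix (Fin 3) (Fin 3) ℂ → ℂ), ContDiff ℝ (⊤ : ℕ∞) Θ →
      HasCompactSupport (fun k : archLocal L 3 (Matrix.diagonal (α' ∘ ⇑τ)) w => Θ ((k : GL (Fin 3) ℂ) : Matrix (Fin 3) (Fin 3) ℂ)) →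
      ∀ (z₀ : Fin 3 → Circle) (h02' : z₀ 0 = z₀ 2) (h01' : z₀ 0 ≠ z₀ 1),
      Tendsto (fun ψ : ℝ => deriv (fun ψ : ℝ => (2 * Real.sin ψ : ℂ) *
      ∫ g, Θ (((g * ⟨circleDiagonal 3 (fun i => z₀ i * Circle.exp (![(1 : ℝ), 0, -1] i * ψ)),
      circleDiagonal_mem_archLocal_diagonal L 3 (α' ∘ ⇑τ) w _⟩ * g⁻¹ : archLocal L 3 (Matrix.diagonal (α' ∘ ⇑τ)) w) : GL (Fin 3) ℂ) : Matrix (Fin 3) (Fin 3) ℂ) ∂(ν)) ψ)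
      (𝓝[≠] 0)
      (𝓝 ((-1 : ℂ) * ∫ y, descConj (⟨circleDiagonal 3 z₀, circleDiagonal_mem_archLocal_diagonal L 3 (α' ∘ ⇑τ) w z₀⟩ : archLocal L 3 (Matrix.diagonal (α' ∘ ⇑τ)) w)
      (Subgroup.centralizer ({(⟨circleDiagonal 3 (z₁ w), circleDiagonal_mem_archLocal_diagonal L 3 (α' ∘ ⇑τ) w (z₁ w)⟩ : archLocal L 3 (Matrix.diagonal (α' ∘ ⇑τ)) w)} : Set (archLocal L 3 (Matrix.diagonal (α' ∘ ⇑τ)) w)))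
      (forall_mem_centralizer_circleDiagonal_comm_of_wall L (α' ∘ ⇑τ) w (h02 w) (h01 w) h02' h01')
      (fun k : archLocal L 3 (Matrix.diagonal (α' ∘ ⇑τ)) w => Θ ((k : GL (Fin 3) ℂ) : Matrix (Fin 3) (Fin 3) ℂ)) y
      ∂(quotientMeasure _ (νH w τ) (isClosed_coe_centralizer_singleton _) (ν)))))
      (z : {w : InfinitePlace L // IsComplex w} → Fin 3 → Circle) (hwall : ∀ w, z w 0 = z w 2 ∧ z w 0 ≠ z w 1)
      (_hrat : ∃ a b : L, ∀ w : {w : InfinitePlace L // IsComplex w}, ((z w 0 : ℂ) = w.1.embedding a) ∧ ((z w 1 : ℂ) = w.1.embedding b))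
      (ρ : {w : InfinitePlace L // IsComplex w} → Perm (Fin 3))
      (ρZ : ∀ (w : {w : InfinitePlace L // IsComplex w}) (σ : Perm (Fin 3)), Measure (Subgroup.centralizer ({(⟨circleDiagonal 3 (z w ∘ ⇑σ), circleDiagonal_mem_archLocal_diagonal L 3 α' w (z w ∘ ⇑σ)⟩ : archLocal L 3 (Matrix.diagonal α') w)} : Set (archLocal L 3 (Matrix.diagonal α') w))))
      (_hρZi : ∀ w σ, (ρZ w σ).IsHaarMeasure ∧ (ρZ w σ).IsInvInvariant)
      (_hρZ : ∀ (w : {w : InfinitePlace L // IsComplex w}) (σ : Perm (Fin 3)), ¬ 0 < (w.1.embedding (α' (σ⁻¹ 0))).re * (w.1.embedding (α' (σ⁻¹ 2))).re →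
      ρZ w σ = (νH w σ⁻¹).map (subgroupCongrHomeomorph (ContinuousMulEquiv.restrictSubgroup (GLn.conjEquiv (Matrix.GeneralLinearGroup.mkOfDetNeZero _ (det_monomial_one_ne_zero 3 σ⁻¹))) (archLocal L 3 (Matrix.diagonal (α' ∘ ⇑σ⁻¹)) w) (archLocal L 3 (Matrix.diagonal α') w) (mem_archLocal_comp_perm_iff_conj_mem L 3 α' w σ⁻¹)).toMulEquiv
      (Subgroup.centralizer ({(⟨circleDiagonal 3 (z₁ w), circleDiagonal_mem_archLocal_diagonal L 3 (α' ∘ ⇑σ⁻¹) w (z₁ w)⟩ : archLocal L 3 (Matrix.diagonal (α' ∘ ⇑σ⁻¹)) w)} : Set (archLocal L 3 (Matrix.diagonal (α' ∘ ⇑σ⁻¹)) w)))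
      (Subgroup.centralizer ({(⟨circleDiagonal 3 (z w ∘ ⇑σ), circleDiagonal_mem_archLocal_diagonal L 3 α' w (z w ∘ ⇑σ)⟩ : archLocal L 3 (Matrix.diagonal α') w)} : Set (archLocal L 3 (Matrix.diagonal α') w)))
      (relabel_inv_mem_centralizer_circleDiagonal_comp_iff L α' w σ (h02 w) (h01 w) (hwall w).1 (hwall w).2)
      (ContinuousMulEquiv.restrictSubgroup (GLn.conjEquiv (Matrix.GeneralLinearGroup.mkOfDetNeZero _ (det_monomial_one_ne_zero 3 σ⁻¹))) (archLocal L 3 (Matrix.diagonal (α' ∘ ⇑σ⁻¹)) w) (archLocal L 3 (Matrix.diagonal α') w) (mem_archLocal_comp_perm_iff_conj_mem L 3 α' w σ⁻¹)).continuous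
      (ContinuousMulEquiv.restrictSubgroup (GLn.conjEquiv (Matrix.GeneralLinearGroup.mkOfDetNeZero _ (det_monomial_one_ne_zero 3 σ⁻¹))) (archLocal L 3 (Matrix.diagonal (α' ∘ ⇑σ⁻¹)) w) (archLocal L 3 (Matrix.diagonal α') w) (mem_archLocal_comp_perm_iff_conj_mem L 3 α' w σ⁻¹)).symm.continuous))
      (_hρZ1 : ∀ (w : {w : InfinitePlace L // IsComplex w}) (σ : Perm (Fin 3)), 0 < (w.1.embedding (α' (σ⁻¹ 0))).re * (w.1.embedding (α' (σ⁻¹ 2))).re → ρZ w σ Set.univ = 1)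
      (ρP : Measure (Subgroup.pi Set.univ (fun w : {w : InfinitePlace L // IsComplex w} => Subgroup.centralizer ({(⟨circleDiagonal 3 (z w ∘ ⇑(ρ w)), circleDiagonal_mem_archLocal_diagonal L 3 α' w (z w ∘ ⇑(ρ w))⟩ : archLocal L 3 (Matrix.diagonal α') w)} : Set (archLocal L 3 (Matrix.diagonal α') w)))))
      (_hρP : Measure.map (subgroupPiCoords fun w : {w : InfinitePlace L // IsComplex w} => Subgroup.centralizer ({(⟨circleDiagonal 3 (z w ∘ ⇑(ρ w)), circleDiagonal_mem_archLocal_diagonal L 3 α' w (z w ∘ ⇑(ρ w))⟩ : archLocal L 3 (Matrix.diagonal α') w)} : Set (archLocal L 3 (Matrix.diagonal α') w))) ρP = Measure.pi fun w => ρZ w (ρ w))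
      (ρ' : Measure (Subgroup.centralizer ({archDiagTorus L 3 α' (fun w => z w ∘ ⇑(ρ w))} : Set (arch (↥(maximalRealSubfield L)) L (IsCMField.complexConj L) 3 (Matrix.diagonal α')))))
      (_hρ' : ρ' = ρP.map (subgroupCongrHomeomorph (archPiEquivCM 3 L (Matrix.diagonal α')).symm.toMulEquiv (Subgroup.pi Set.univ (fun w : {w : InfinitePlace L // IsComplex w} => Subgroup.centralizer ({(⟨circleDiagonal 3 (z w ∘ ⇑(ρ w)), circleDiagonal_mem_archLocal_diagonal L 3 α' w (z w ∘ ⇑(ρ w))⟩ : archLocal L 3 (Matrix.diagonal α') w)} : Set (archLocal L 3 (Matrix.diagonal α') w)))) (Subgroup.centralizer ({archDiagTorus L 3 α' (fun w => z w ∘ ⇑(ρ w))} : Set (arch (↥(maximalRealSubfield L)) L (IsCMField.complexConj L) 3 (Matrix.diagonal α')))) (apply_mem_centralizer_iff_mem_pi_centralizer _ (archPiEquivCM 3 L (Matrix.diagonal α')).symm.toMulEquiv (archPiEquivCM_symm_circleDiagonal_eq_archDiagTorus L 3 α' (fun w => z w ∘ ⇑(ρ w)))) (archPiEquivCM 3 L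 (Matrix.diagonal α')).symm.continuous (archPiEquivCM 3 L (Matrix.diagonal α')).continuous)),
      centralizerTopFormHaar L (Matrix.diagonal α') (archDiagTorus L 3 α' (fun w => z w ∘ ⇑(ρ w))) = K • ρ')
    (hfin : TamagawaSingularMembersFinTFClosed) : TamagawaSingularMembersExistClosed := by
  intro L _ _ _ H' Tinf
  intros
  exact tamagawaSingularMembersExist_of_finTF_of_U L H' Tinf _ _ _ _ _ _ (hU L) (hfin L H' Tinf _ _ _ _ _ _)

end Literature.NumberTheory.Rogawski1990

end
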